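import Literature.RingTheory.MvPolynomial.HypersurfaceFunctionField
import Mathlib.RingTheory.Derivation.MapCoeffs
import Mathlib.Algebra.Polynomial.Module.Basic
import Mathlib.Algebra.Polynomial.Div
import HarnessLib

/-!
# Taylor expansion along lines via derivations: the truncated exponential of a derivation

Topic `Literature/RingTheory/MvPolynomial`. Everything in this file is PROVED. It is the second
layer (after `HypersurfaceFunctionField.lean`) of the algebraic treatment of the local geometry
of a surface `{f = 0} ⊆ K³` in its function field `L = K(S)`: the formal statement that the
"osculating data" `T_k(σ) = (D₀ + σ D₁)ᵏ z̄ ∈ L[σ]` of the slope `σ` (a formal constant) are the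
Taylor coefficients of the surface along the tangent direction `(1, σ, T₁(σ))` at the generic
point `ξ = (x̄₀, x̄₁, z̄)`:

  `f(x̄₀ + t, x̄₁ + σ t, Σ_{k ≤ N} T_k(σ) tᵏ / k!) ≡ 0 (mod t^{N+1})` in `L[σ][t]`

(`Hypersurface.coeff_aeval_lineTaylor_eq_zero`), whenever `1!, …, N!` are invertible in `K`.

## Contents

* `Derivation.iterate_leibniz` — the general Leibniz rule
  `δⁿ(ab) = Σ_k C(n,k) δⁿ⁻ᵏ(a) δᵏ(b)` for a derivation `δ` of a commutative algebra (the proof of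
  Mathlib's `Polynomial.iterate_derivative_mul`, verbatim for an abstract derivation).
* `truncExp N δ b = Σ_{k ≤ N} (δᵏ b / k!) tᵏ ∈ B[t]` — the **truncated exponential** of a
  `K`-derivation `δ` of a commutative `K`-algebra `B`; it is additive, kills nothing of degree
  `≤ N` of products (`coeff_truncExp_mul`: `truncExp(ab) ≡ truncExp(a) truncExp(b) mod t^{N+1}`
  when `k!` is invertible for `k ≤ N`), hence induces an algebra homomorphism
  `truncExpHom : B →ₐ[K] B[t] ⧸ (t^{N+1})` and commutes with polynomial substitution
  (`coeff_truncExp_aeval`).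
* For an irreducible `f ∈ K[X₀,X₁,X₂]` with `∂₂f ∉ (f)`: the **slope derivation**
  `Hypersurface.slopeDeriv f = D₀ + σ D₁` of `L[σ]` (`D₀, D₁` the commuting graph derivations
  `Hypersurface.gD f 0, gD f 1`, acting coefficientwise), the osculating polynomials
  `Hypersurface.osc f k = (slopeDeriv f)ᵏ (C z̄)`, and the Taylor identity above.

## References
* [Kollar2015] J. Kollár, *Szemerédi–Trotter-type theorems in dimension 3*, Adv. Math. 271
  (2015), §6 (analytic sketch of Monge–Salmon–Cayley: "expand `F(x + t, y + σt)` …"); this file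
  is the algebraic replacement of that expansion. Standard algebra otherwise. [folklore]
-/

namespace Literature.RingTheory.MvPolynomial

open Polynomial Finset
open scoped Nat

/-! ### The general Leibniz rule for a derivation -/

section IterateLeibniz

variable {R A : Type*} [CommSemiring R] [CommRing A] [Algebra R A]

/-- **General Leibniz rule**: `δⁿ(p q) = Σ_{k ≤ n} C(n,k) δⁿ⁻ᵏ(p) δᵏ(q)` for a derivation `δ`
of a commutative algebra. (Proof as for Mathlib's `Polynomial.iterate_derivative_mul`.)
[folklore] -/
theorem _root_.Derivation.iterate_leibniz (δ : Derivation R A A) (n : ℕ) (p q : A) :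
    δ^[n] (p * q) = ∑ k ∈ range n.succ, (n.choose k • (δ^[n - k] p * δ^[k] q)) := by
  induction n with
  | zero => simp [Finset.range]
  | succ n IH =>
    calc
      δ^[n + 1] (p * q) =
          δ (∑ k ∈ range n.succ, n.choose k • (δ^[n - k] p * δ^[k] q)) := by
        rw [Function.iterate_succ_apply', IH]
      _ = (∑ k ∈ range n.succ, n.choose k • (δ^[n - k + 1] p * δ^[k] q)) +
          ∑ k ∈ range n.succ, n.choose k • (δ^[n - k] p * δ^[k + 1] q) := by
        rw [map_sum, ← sum_add_distrib]
        refine sum_congr rfl fun k _ => ?_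
        rw [map_nsmul, Derivation.leibniz, smul_eq_mul, smul_eq_mul, ← smul_add,
          Function.iterate_succ_apply', Function.iterate_succ_apply']
        congr 1
        ring
      _ = (∑ k ∈ range n.succ,
                n.choose k.succ • (δ^[n - k] p * δ^[k + 1] q)) +
              1 • (δ^[n + 1] p * δ^[0] q) +
            ∑ k ∈ range n.succ, n.choose k • (δ^[n - k] p * δ^[k + 1] q) :=
        ?_
      _ = ((∑ k ∈ range n.succ, n.choose k • (δ^[n - k] p * δ^[k + 1] q)) +
              ∑ k ∈ range n.succ,
                n.choose k.succ • (δ^[n - k] p * δ^[k + 1] q)) +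
            1 • (δ^[n + 1] p * δ^[0] q) := by
        rw [add_comm, add_assoc]
      _ = (∑ i ∈ range n.succ,
              (n + 1).choose (i + 1) • (δ^[n + 1 - (i + 1)] p * δ^[i + 1] q)) +
            1 • (δ^[n + 1] p * δ^[0] q) := by
        simp_rw [Nat.choose_succ_succ, Nat.succ_sub_succ, add_smul, sum_add_distrib]
      _ = ∑ k ∈ range n.succ.succ, n.succ.choose k • (δ^[n.succ - k] p * δ^[k] q) := by
        rw [sum_range_succ' _ n.succ, Nat.choose_zero_right, tsub_zero]
    congr
    refine (sum_range_succ' _ _).trans (congr_arg₂ (· + ·) ?_ ?_)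
    · rw [sum_range_succ, Nat.choose_succ_self, zero_smul, add_zero]
      refine sum_congr rfl fun k hk => ?_
      rw [mem_range] at hk
      congr
      omega
    · rw [Nat.choose_zero_right, tsub_zero]

/-- Iterates of a derivation are additive. [folklore] -/
theorem _root_.Derivation.iterate_map_add (δ : Derivation R A A) (n : ℕ) (a b : A) :
    δ^[n] (a + b) = δ^[n] a + δ^[n] b := by
  induction n with
  | zero => rfl
  | succ n ih =>
    rw [Function.iterate_succ_apply', Function.iterate_succ_apply', Function.iterate_succ_apply',
      ih, map_add]

/-- Iterates of a derivation commute with scalars. [folklore] -/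
theorem _root_.Derivation.iterate_map_smul (δ : Derivation R A A) (n : ℕ) (c : R) (a : A) :
    δ^[n] (c • a) = c • δ^[n] a := by
  induction n with
  | zero => rfl
  | succ n ih =>
    rw [Function.iterate_succ_apply', Function.iterate_succ_apply', ih, Derivation.map_smul]

/-- Positive iterates of a derivation kill scalars. [folklore] -/
theorem _root_.Derivation.iterate_algebraMap (δ : Derivation R A A) {n : ℕ} (hn : n ≠ 0) (c : R) :
    δ^[n] (algebraMap R A c) = 0 := by
  obtain ⟨m, rfl⟩ := Nat.exists_eq_succ_of_ne_zero hn
  rw [Function.iterate_succ_apply, Derivation.map_algebraMap]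
  exact Function.iterate_fixed (map_zero δ) m

end IterateLeibniz

/-! ### The truncated exponential of a derivation -/

section TruncExp

variable {K : Type*} [Field K] {B : Type*} [CommRing B] [Algebra K B]

/-- The truncated exponential `Σ_{k ≤ N} (δᵏ b / k!) tᵏ ∈ B[t]` of a `K`-derivation `δ`.
[folklore] -/
noncomputable def truncExp (N : ℕ) (δ : Derivation K B B) (b : B) : Polynomial B :=
  ∑ k ∈ range (N + 1), C (((k ! : ℕ) : K)⁻¹ • (δ^[k] b)) * X ^ k

/-- Coefficients of the truncated exponential. [folklore] -/
theorem coeff_truncExp (N : ℕ) (δ : Derivation K B B) (b : B) (n : ℕ) :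
    (truncExp N δ b).coeff n = if n ≤ N then ((n ! : ℕ) : K)⁻¹ • (δ^[n] b) else 0 := by
  rw [truncExp, finsetSum_coeff]
  simp_rw [coeff_C_mul_X_pow]
  split_ifs with hn
  · rw [Finset.sum_eq_single n]
    · rw [if_pos rfl]
    · intro k _ hkn
      rw [if_neg (Ne.symm hkn)]
    · intro h
      exact absurd (mem_range.2 (Nat.lt_succ_of_le hn)) h
  · refine Finset.sum_eq_zero fun k hk => ?_
    rw [if_neg]
    rintro rfl
    exact hn (Nat.le_of_lt_succ (mem_range.1 hk))

/-- `truncExp` is additive. [folklore] -/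
theorem truncExp_add (N : ℕ) (δ : Derivation K B B) (a b : B) :
    truncExp N δ (a + b) = truncExp N δ a + truncExp N δ b := by
  ext n
  simp only [coeff_truncExp, coeff_add]
  split_ifs
  · rw [Derivation.iterate_map_add, smul_add]
  · rw [add_zero]

/-- `truncExp` on scalars. [folklore] -/
theorem truncExp_algebraMap (N : ℕ) (δ : Derivation K B B) (c : K) :
    truncExp N δ (algebraMap K B c) = C (algebraMap K B c) := by
  ext n
  rw [coeff_truncExp, coeff_C]
  by_cases hn : n = 0
  · subst hn
    simp
  · rw [if_neg hn]
    split_ifs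
    · rw [Derivation.iterate_algebraMap δ hn, smul_zero]
    · rfl

/-- `truncExp 1 = 1`. [folklore] -/
theorem truncExp_one (N : ℕ) (δ : Derivation K B B) : truncExp N δ 1 = 1 := by
  have := truncExp_algebraMap N δ 1
  rwa [map_one, map_one] at this

/-- `truncExp 0 = 0`. [folklore] -/
theorem truncExp_zero (N : ℕ) (δ : Derivation K B B) : truncExp N δ 0 = 0 := by
  have := truncExp_algebraMap N δ 0
  rwa [map_zero, map_zero] at this

/-- If `k! ≠ 0` in `K` for all `k ≤ N`, then `i! (n - i)! ≠ 0` for `i ≤ n ≤ N`, and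
`(n!)⁻¹ C(n, i) = (i!)⁻¹ ((n-i)!)⁻¹`. [folklore] -/
theorem factorial_inv_mul_choose {N n i : ℕ} (hN : ∀ k, k ≤ N → ((k ! : ℕ) : K) ≠ 0)
    (hn : n ≤ N) (hi : i ≤ n) :
    ((n ! : ℕ) : K)⁻¹ * (n.choose i : K) = ((i ! : ℕ) : K)⁻¹ * (((n - i) ! : ℕ) : K)⁻¹ := by
  have hi' : ((i ! : ℕ) : K) ≠ 0 := hN i (hi.trans hn)
  have hni : (((n - i) ! : ℕ) : K) ≠ 0 := hN (n - i) ((Nat.sub_le n i).trans hn)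
  have hnn : ((n ! : ℕ) : K) ≠ 0 := hN n hn
  have key : (n.choose i : K) * ((i ! : ℕ) : K) * (((n - i) ! : ℕ) : K) = ((n ! : ℕ) : K) := by
    have h := congrArg (Nat.cast (R := K)) (Nat.choose_mul_factorial_mul_factorial hi)
    push_cast at h
    exact h
  field_simp
  linear_combination key

/-- **Multiplicativity of the truncated exponential**: if `k!` is invertible in `K` for `k ≤ N`,
then `truncExp(ab)` and `truncExp(a) truncExp(b)` agree in degrees `≤ N` (general Leibniz rule).
[folklore] -/
theorem coeff_truncExp_mul {N : ℕ} (hN : ∀ k, k ≤ N → ((k ! : ℕ) : K) ≠ 0)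
    (δ : Derivation K B B) (a b : B) {n : ℕ} (hn : n ≤ N) :
    (truncExp N δ a * truncExp N δ b).coeff n = (truncExp N δ (a * b)).coeff n := by
  rw [coeff_mul, coeff_truncExp, if_pos hn, mul_comm a b, Derivation.iterate_leibniz,
    Finset.smul_sum, Nat.sum_antidiagonal_eq_sum_range_succ_mk]
  refine Finset.sum_congr rfl fun i hi => ?_
  dsimp only
  have hi' : i ≤ n := Nat.le_of_lt_succ (mem_range.1 hi)
  rw [coeff_truncExp, coeff_truncExp, if_pos (hi'.trans hn), if_pos ((Nat.sub_le n i).trans hn)]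
  rw [smul_mul_smul_comm, ← Nat.cast_smul_eq_nsmul K, smul_smul, factorial_inv_mul_choose hN hn hi',
    mul_comm (δ^[i] a)]

/-- **The truncated exponential as an algebra homomorphism** `B → B[t] ⧸ (t^{N+1})`.
[folklore] -/
noncomputable def truncExpHom {N : ℕ} (hN : ∀ k, k ≤ N → ((k ! : ℕ) : K) ≠ 0)
    (δ : Derivation K B B) : B →ₐ[K] (Polynomial B ⧸ Ideal.span {(X : Polynomial B) ^ (N + 1)}) where
  toFun b := Ideal.Quotient.mk _ (truncExp N δ b)
  map_one' := by rw [truncExp_one, map_one]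
  map_mul' a b := by
    rw [← map_mul]
    refine (Ideal.Quotient.eq).2 ?_
    rw [Ideal.mem_span_singleton, X_pow_dvd_iff]
    intro d hd
    rw [coeff_sub, coeff_truncExp_mul hN δ a b (Nat.le_of_lt_succ hd), sub_self]
  map_zero' := by rw [truncExp_zero, map_zero]
  map_add' a b := by rw [truncExp_add, map_add]
  commutes' c := by
    rw [truncExp_algebraMap]
    rfl

/-- Unfolding `truncExpHom`. [folklore] -/
theorem truncExpHom_apply {N : ℕ} (hN : ∀ k, k ≤ N → ((k ! : ℕ) : K) ≠ 0)
    (δ : Derivation K B B) (b : B) :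
    truncExpHom hN δ b = Ideal.Quotient.mk _ (truncExp N δ b) := rfl

/-- **The truncated exponential commutes with polynomial substitution** in degrees `≤ N`:
`truncExp (P(b₁, …, b_m)) ≡ P(truncExp b₁, …, truncExp b_m) (mod t^{N+1})`. [folklore] -/
theorem coeff_truncExp_aeval {N : ℕ} (hN : ∀ k, k ≤ N → ((k ! : ℕ) : K) ≠ 0)
    (δ : Derivation K B B) {ι : Type*} (b : ι → B) (P : MvPolynomial ι K) {n : ℕ} (hn : n ≤ N) :
    (truncExp N δ (MvPolynomial.aeval b P)).coeff n =
      (MvPolynomial.aeval (fun i => truncExp N δ (b i)) P).coeff n := by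
  have h1 : truncExpHom hN δ (MvPolynomial.aeval b P) =
      MvPolynomial.aeval (fun i => truncExpHom hN δ (b i)) P := by
    rw [← AlgHom.comp_apply, MvPolynomial.comp_aeval]
  have h2 : Ideal.Quotient.mkₐ K (Ideal.span {(X : Polynomial B) ^ (N + 1)})
      (MvPolynomial.aeval (fun i => truncExp N δ (b i)) P) =
      MvPolynomial.aeval (fun i => truncExpHom hN δ (b i)) P := by
    rw [← AlgHom.comp_apply, MvPolynomial.comp_aeval]
    rfl
  rw [truncExpHom_apply, ← h2, Ideal.Quotient.mkₐ_eq_mk, Ideal.Quotient.eq,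
    Ideal.mem_span_singleton, X_pow_dvd_iff] at h1
  have := h1 n (Nat.lt_succ_of_le hn)
  rwa [coeff_sub, sub_eq_zero] at this

end TruncExp

/-! ### The slope derivation of a surface and the Taylor identity along the generic line -/

namespace Hypersurface

variable {K : Type*} [Field K] (f : MvPolynomial (Fin 3) K) [Fact (Irreducible f)]

/-- Coefficientwise action of a derivation of `L = K(S)` on `L[σ]`. [folklore] -/
noncomputable def cw (D : Derivation K (FnField f) (FnField f)) :
    Derivation K (Polynomial (FnField f)) (Polynomial (FnField f)) :=
  PolynomialModule.equivPolynomialSelf.compDer D.mapCoeffs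

/-- `cw D` acts on coefficients. [folklore] -/
theorem coeff_cw (D : Derivation K (FnField f) (FnField f)) (p : Polynomial (FnField f)) (i : ℕ) :
    (cw f D p).coeff i = D (p.coeff i) := rfl

/-- `cw D (C a) = C (D a)`. [folklore] -/
theorem cw_C (D : Derivation K (FnField f) (FnField f)) (a : FnField f) :
    cw f D (C a) = C (D a) := by
  ext i
  rw [coeff_cw, coeff_C, coeff_C]
  split_ifs
  · rfl
  · exact map_zero D

/-- `cw D σ = 0` (the slope is a constant). [folklore] -/
theorem cw_X (D : Derivation K (FnField f) (FnField f)) : cw f D X = 0 := by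
  ext i
  rw [coeff_cw, coeff_X, coeff_zero]
  split_ifs
  · exact D.map_one_eq_zero
  · exact map_zero D

/-- **The slope derivation** `𝒟 = D₀ + σ D₁` of `L[σ]` (`D₀, D₁` the graph derivations acting on
coefficients, `σ` the formal slope). [folklore] -/
noncomputable def slopeDeriv : Derivation K (Polynomial (FnField f)) (Polynomial (FnField f)) :=
  cw f (gD f 0) + (X : Polynomial (FnField f)) • cw f (gD f 1)

/-- `𝒟 (C a) = C (D₀ a) + σ C (D₁ a)`. [folklore] -/
theorem slopeDeriv_C (a : FnField f) :
    slopeDeriv f (C a) = C (gD f 0 a) + X * C (gD f 1 a) := by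
  rw [slopeDeriv, Derivation.add_apply, Derivation.smul_apply, cw_C, cw_C, smul_eq_mul]

/-- `𝒟 σ = 0`. [folklore] -/
theorem slopeDeriv_X : slopeDeriv f X = 0 := by
  rw [slopeDeriv, Derivation.add_apply, Derivation.smul_apply, cw_X, cw_X, smul_zero, add_zero]

/-- **The osculating polynomials** `T_k(σ) = 𝒟ᵏ (z̄) ∈ L[σ]` of the surface (`z̄ = x̄₂`).
[folklore] -/
noncomputable def osc (k : ℕ) : Polynomial (FnField f) :=
  (slopeDeriv f)^[k] (C (toFn f (MvPolynomial.X 2)))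

/-- `T₀ = z̄`. [folklore] -/
theorem osc_zero : osc f 0 = C (toFn f (MvPolynomial.X 2)) := rfl

/-- `T_{k+1} = 𝒟 T_k`. [folklore] -/
theorem osc_succ (k : ℕ) : osc f (k + 1) = slopeDeriv f (osc f k) := by
  rw [osc, Function.iterate_succ_apply']
  rfl

variable {f}

/-- `truncExp 𝒟 (x̄₀) = x̄₀ + t`. [folklore] -/
theorem truncExp_slopeDeriv_X_zero (h2 : toFn f (MvPolynomial.pderiv 2 f) ≠ 0) {N : ℕ} (hN1 : 1 ≤ N) :
    truncExp N (slopeDeriv f) (C (toFn f (MvPolynomial.X 0))) =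
      C (C (toFn f (MvPolynomial.X 0))) + X := by
  have h1 : slopeDeriv f (C (toFn f (MvPolynomial.X 0))) = 1 := by
    rw [slopeDeriv_C, gD_X_self h2 (show (0 : Fin 3) ≠ 2 by decide),
      gD_X_of_ne h2 (show (1 : Fin 3) ≠ 2 by decide) (show (0 : Fin 3) ≠ 1 by decide)
        (show (0 : Fin 3) ≠ 2 by decide), map_one, map_zero, mul_zero, add_zero]
  have hk : ∀ k, (slopeDeriv f)^[k + 2] (C (toFn f (MvPolynomial.X 0))) = 0 := by
    intro k
    rw [Function.iterate_add_apply, Function.iterate_succ_apply, Function.iterate_one, h1,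
      Derivation.map_one_eq_zero]
    exact Function.iterate_fixed (map_zero _) k
  refine Polynomial.ext fun n => ?_
  rw [coeff_truncExp, coeff_add, coeff_C, coeff_X]
  match n with
  | 0 => simp
  | 1 => simp [h1, hN1]
  | n + 2 =>
    rw [if_neg (show n + 2 ≠ 0 by omega), if_neg (show (1 : ℕ) ≠ n + 2 by omega), add_zero]
    split_ifs
    · rw [hk n, smul_zero]
    · rfl

/-- `truncExp 𝒟 (x̄₁) = x̄₁ + σ t`. [folklore] -/
theorem truncExp_slopeDeriv_X_one (h2 : toFn f (MvPolynomial.pderiv 2 f) ≠ 0) {N : ℕ} (hN1 : 1 ≤ N) :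
    truncExp N (slopeDeriv f) (C (toFn f (MvPolynomial.X 1))) =
      C (C (toFn f (MvPolynomial.X 1))) + C X * X := by
  have h1 : slopeDeriv f (C (toFn f (MvPolynomial.X 1))) = X := by
    rw [slopeDeriv_C, gD_X_self h2 (show (1 : Fin 3) ≠ 2 by decide),
      gD_X_of_ne h2 (show (0 : Fin 3) ≠ 2 by decide) (show (1 : Fin 3) ≠ 0 by decide)
        (show (1 : Fin 3) ≠ 2 by decide), map_one, map_zero, mul_one, zero_add]
  have hk : ∀ k, (slopeDeriv f)^[k + 2] (C (toFn f (MvPolynomial.X 1))) = 0 := by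
    intro k
    rw [Function.iterate_add_apply, Function.iterate_succ_apply, Function.iterate_one, h1,
      slopeDeriv_X]
    exact Function.iterate_fixed (map_zero _) k
  refine Polynomial.ext fun n => ?_
  rw [coeff_truncExp, coeff_add, coeff_C, coeff_C_mul, coeff_X]
  match n with
  | 0 => simp
  | 1 => simp [h1, hN1]
  | n + 2 =>
    rw [if_neg (show n + 2 ≠ 0 by omega), if_neg (show (1 : ℕ) ≠ n + 2 by omega), mul_zero,
      add_zero]
    split_ifs
    · rw [hk n, smul_zero]
    · rfl

/-- `truncExp 𝒟 (z̄) = Σ_{k ≤ N} T_k tᵏ / k!`. [folklore] -/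
theorem truncExp_slopeDeriv_X_two (N : ℕ) :
    truncExp N (slopeDeriv f) (C (toFn f (MvPolynomial.X 2))) =
      ∑ k ∈ range (N + 1), C (((k ! : ℕ) : K)⁻¹ • osc f k) * X ^ k := rfl

/-- `f` vanishes at the generic point: `f(x̄₀, x̄₁, x̄₂) = 0` in `L`, hence in `L[σ]`.
[folklore] -/
theorem aeval_C_toFn_X (f : MvPolynomial (Fin 3) K) [Fact (Irreducible f)] :
    MvPolynomial.aeval (fun i => (C (toFn f (MvPolynomial.X i)) : Polynomial (FnField f))) f = 0 := by
  have h1 : MvPolynomial.aeval (fun i => toFn f (MvPolynomial.X i)) f = toFn f f := by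
    conv_rhs => rw [MvPolynomial.aeval_unique (toFn f)]
    rfl
  have h2 : MvPolynomial.aeval (fun i => (C (toFn f (MvPolynomial.X i)) : Polynomial (FnField f))) f
      = (CAlgHom : FnField f →ₐ[K] Polynomial (FnField f))
          (MvPolynomial.aeval (fun i => toFn f (MvPolynomial.X i)) f) := by
    rw [← AlgHom.comp_apply, MvPolynomial.comp_aeval]
    rfl
  rw [h2, h1, toFn_self, map_zero]

/-- **Taylor identity along the generic line.** In `L[σ][t]` (`L = K(S)`, `σ` the formal slope,
`t` the line parameter), if `1!, …, N!` are invertible in `K` and `∂₂f ∉ (f)`: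
`f(x̄₀ + t, x̄₁ + σ t, Σ_{k ≤ N} T_k(σ) tᵏ/k!) ≡ 0 (mod t^{N+1})` — all its coefficients of
degree `≤ N` vanish. (The exponential of the slope derivation is a homomorphism and kills
`f(x̄₀, x̄₁, x̄₂) = 0`.) [folklore] -/
theorem coeff_aeval_lineTaylor_eq_zero (h2 : toFn f (MvPolynomial.pderiv 2 f) ≠ 0) {N : ℕ} (hN1 : 1 ≤ N)
    (hN : ∀ k, k ≤ N → ((k ! : ℕ) : K) ≠ 0) {n : ℕ} (hn : n ≤ N) :
    (MvPolynomial.aeval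
      ![C (C (toFn f (MvPolynomial.X 0))) + (X : Polynomial (Polynomial (FnField f))),
        C (C (toFn f (MvPolynomial.X 1))) + C X * X,
        ∑ k ∈ range (N + 1), C (((k ! : ℕ) : K)⁻¹ • osc f k) * X ^ k] f).coeff n = 0 := by
  have key := coeff_truncExp_aeval hN (slopeDeriv f)
    (fun i => (C (toFn f (MvPolynomial.X i)) : Polynomial (FnField f))) f hn
  rw [aeval_C_toFn_X, truncExp_zero, coeff_zero] at key
  have hv : (fun i => truncExp N (slopeDeriv f) (C (toFn f (MvPolynomial.X i)))) =
      ![C (C (toFn f (MvPolynomial.X 0))) + (X : Polynomial (Polynomial (FnField f))),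
        C (C (toFn f (MvPolynomial.X 1))) + C X * X,
        ∑ k ∈ range (N + 1), C (((k ! : ℕ) : K)⁻¹ • osc f k) * X ^ k] := by
    funext i
    match i with
    | 0 => exact truncExp_slopeDeriv_X_zero h2 hN1
    | 1 => exact truncExp_slopeDeriv_X_one h2 hN1
    | 2 => exact truncExp_slopeDeriv_X_two N
  rw [hv] at key
  exact key.symm

end Hypersurface

end Literature.RingTheory.MvPolynomial
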